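/-
Copyright (c) 2026. All rights reserved.
Released under Apache 2.0 license as described in the file LICENSE.
Authors: abc-iut cell, statement-typer seat abc-iut-L4-t3 (wave 1).
-/
import Mathlib.NumberTheory.NumberField.InfinitePlace.Basic
import Mathlib.RingTheory.DedekindDomain.AdicValuation
import Mathlib.RingTheory.DedekindDomain.IntegralClosure
import Mathlib.LinearAlgebra.Dimension.Finite
import Mathlib.LinearAlgebra.LinearIndependent.Lemmas
import Mathlib.Algebra.BigOperators.Finprod
import Mathlib.Analysis.SpecialFunctions.Log.Basic
import Mathlib.RingTheory.DedekindDomain.FiniteAdeleRing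
import Literature.IUT.LogVolume.ArakelovDivisors
import HarnessLib

/-!
# [AbsTopIII] Definition 5.3 (i)–(iii), Definition 5.9 (iii): `⊠`- and `⊞`-line bundles on a number field and their global log-volume

S. Mochizuki, *Topics in absolute anabelian geometry III: global reconstruction algorithms*,
J. Math. Sci. Univ. Tokyo 22 (2015) 939–1156 [MochizukiAbsTopIII2015]; locators `p.N` = pages of the
author's manuscript (`paper:url-5493eb38cbb7`; journal pagination not held), read on the page: Def 5.3 (i)
pp. 122–123, (ii) pp. 123–124, (iii) p. 124; Rmk 5.3.1 p. 124; Rmk 5.4.3 p. 129; Def 5.9 (iii) p. 144.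

## What is typed and how

Def 5.3 defines, on a global `T`-pair `M⊚` with global Galois group `Π`, the categories of `⊠`-line bundles
(`T = TLG`: an `(M⊚)^Π`-torsor `L⊠[⊚]` with an `Out(Π)`-action + local trivializations `τ[v]` of the torsors over
the value groups `(M_v^{Π_v})_{TV} ≅ ℤ / ℝ`, almost all determined by any global element) and of `⊞`-line bundles
(`T = TF`: a rank one projective `𝒪^Π_{M⊚}`-module `L⊞[⊚]` with an `Out(Π)`-action + Hermitian metrics at the
archimedean `v`), the equivalence `⊞ ≃ ⊠` and the coarsified versions `|⊡|`. Here `(M⊚)^Π = F` is the base number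
field, `𝒪^Π_{M⊚} = 𝒪_F`. This file gives the CONCRETE ARITHMETIC CONTENT as REAL definitions over a Mathlib number
field `F` in the case of TRIVIAL `Out(Π)`-twist (`F = F_mod`; TODO(general form): the `Out(Π) ↠ Gal(F/F_mod)`-
equivariance datum of Def 5.3 (i), (ii) is not typed here):

* `MulLineBundle F` (Def 5.3 (i)): an `F^×`-torsor `T` with, for every place `v`, a trivialization of the induced
  torsor over the value group, modelled as an EQUIVARIANT map `τ_v : T → ℤ` (resp. `→ ℝ`),
  `τ_v(a·t) = ord_v(a) + τ_v(t)` (resp. `= -log|a|_v + τ_v(t)`), with `τ_v(t) = 0` for almost all `v`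
  (orientation: "integral" = `τ ≥ 0`); morphisms = torsor isomorphisms `ζ` with `τ₁[v](t) ≤ τ₂[v](ζ t)` (the
  printed "maps `τ₁[v]` to an element `≤ τ₂[v]`" in this orientation);
* `AddLineBundle F` (Def 5.3 (ii)): a finitely generated projective `𝒪_F`-module of rank one with, at each
  archimedean `v`, a Hermitian norm (recorded by its restriction `L → ℝ`, `|a·x|_v = |a|_v·|x|_v`); morphisms =
  nonzero `𝒪_F`-linear maps mapping integral elements (norm `≤ 1`) to integral elements; the trivial `⊞`-line
  bundle `𝒪_F`;
* Def 5.3 (iii): the coarsified hom-sets (orbits under roots of unity) `AddLineBundle.HomCoarse`;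
* the equivalence `Th⊚⊞ ≃ Th⊚⊠` (Def 5.3 (ii), last paragraph) and "the automorphism group of any object is
  `μ(F)`" (Def 5.3 (iii)) as named facts; Rmk 5.3.1 / 5.4.3 recorded in docstrings;
* Def 5.9 (iii): the GLOBAL LOG-VOLUME `μ^log_⊚(L⊞) := Σ_{v arc} 2·μ^log_v(S_v)/d_v^mod + Σ_{v non} μ^log_v(S_v)/d_v^mod`
  as a real-valued formula in given local log-volumes and weights (`globalLogVolume`); its independence of the
  choices "by the product formula" as a named fact shape.

NOT here: the Galois-theater wrapping (`GaloisTheaters.lean`), the local log-volumes themselves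
(`LocalVolumes*.lean`), Arakelov degrees of c312-3's `Literature/IUT/LogVolume/ArakelovDivisors` (whose normalised
valuation `ord` we REUSE for `ordAt`; no second definition; we only type the [AbsTopIII] objects and formula). Refereed pre-IUT material; nothing here bears on [IUTchIII] Cor. 3.12.
-/

set_option autoImplicit false

noncomputable section

open NumberField IsDedekindDomain
open scoped Classical

namespace Literature.AnabelianGeometry.AbsoluteAnabelian

universe u

variable (F : Type) [Field F] [NumberField F]

/-! ## `ord_v` and `-log|·|_v` on `F^×` (the value groups `(M_v^{Π_v})_{TV} ≅ ℤ`, `≅ ℝ`) -/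

/-- `ord_v : F^× → ℤ` at a finite place `v` (the valuation of the value group `F_v^×/𝒪_v^× ≅ ℤ`, normalised so that
uniformisers have `ord_v = 1`) — the tree's `Literature.IUT.LogVolume.ord` (ArakelovDivisors.lean) restricted to units;
no second definition. [cite: MochizukiAbsTopIII2015, Def 5.3 (i) p. 122] -/
abbrev ordAt (v : HeightOneSpectrum (𝓞 F)) (a : Fˣ) : ℤ := Literature.IUT.LogVolume.ord F v (a : F)

/-- `-log|a|_v` at an archimedean place `v` (the value group `F_v^×/𝒪_v^× ≅ ℝ`, oriented so that "integral" is
nonnegative). [cite: MochizukiAbsTopIII2015, Def 5.3 (i) p. 122] -/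
def negLogAt (v : InfinitePlace F) (a : Fˣ) : ℝ := -Real.log (v (a : F))

/-! ## Def 5.3 (i): `⊠`-line bundles -/

/-- A **`⊠`-line bundle** on the number field `F` (Def 5.3 (i), trivial `Out(Π)`-twist): an `F^×`-torsor `L⊠[⊚]`
together with, for each `v ∈ V(F)`, a trivialization `τ[v]` of the induced torsor over the value group
`F_v^×/𝒪_v^×` — recorded as an equivariant map to `ℤ` (resp. `ℝ`) — "such that any element of `L⊠[⊚]` determines
the element of `L⊠[v]_{TV}` given by `τ[v]`, for all but finitely many `v`". [cite: MochizukiAbsTopIII2015, Def 5.3 (i) p. 122] -/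
structure MulLineBundle : Type 1 where
  /-- the torsor `L⊠[⊚]` -/
  T : Type
  /-- the `F^×`-action -/
  [action : MulAction Fˣ T]
  /-- `L⊠[⊚]` is nonempty -/
  nonempty : Nonempty T
  /-- … and a torsor: `a ↦ a·t` is a bijection for every `t` -/
  bijective_smul : ∀ t : T, Function.Bijective fun a : Fˣ => a • t
  /-- `τ[v]` at finite `v` -/
  τnon : HeightOneSpectrum (𝓞 F) → T → ℤ
  /-- `τ[v]` is a trivialization of the induced `ℤ`-torsor -/
  τnon_smul : ∀ v (a : Fˣ) (t : T), τnon v (a • t) = ordAt F v a + τnon v t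
  /-- `τ[v]` at archimedean `v` -/
  τarc : InfinitePlace F → T → ℝ
  /-- `τ[v]` is a trivialization of the induced `ℝ`-torsor -/
  τarc_smul : ∀ v (a : Fˣ) (t : T), τarc v (a • t) = negLogAt F v a + τarc v t
  /-- any `t ∈ L⊠[⊚]` determines `τ[v]` for all but finitely many `v` -/
  finite_support : ∀ t : T, {v | τnon v t ≠ 0}.Finite

attribute [instance] MulLineBundle.action

namespace MulLineBundle

variable {F}

/-- A **morphism of `⊠`-line bundles** `ζ : L⊠₁ → L⊠₂`: an isomorphism of `F^×`-torsors such that each `v` induces a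
map `L⊠₁[v]_{TV} → L⊠₂[v]_{TV}` sending `τ₁[v]` to an element `≤ τ₂[v]` (in our orientation: `τ₁[v](t) ≤ τ₂[v](ζ t)`).
[cite: MochizukiAbsTopIII2015, Def 5.3 (i) p. 123] -/
structure Hom (L₁ L₂ : MulLineBundle F) : Type where
  /-- `ζ[⊚]` -/
  toEquiv : L₁.T ≃ L₂.T
  /-- equivariance -/
  map_smul : ∀ (a : Fˣ) (t : L₁.T), toEquiv (a • t) = a • toEquiv t
  /-- `τ₁[v] ≤ τ₂[v]` at finite `v` -/
  τnon_le : ∀ v t, L₁.τnon v t ≤ L₂.τnon v (toEquiv t)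
  /-- `τ₁[v] ≤ τ₂[v]` at archimedean `v` -/
  τarc_le : ∀ v t, L₁.τarc v t ≤ L₂.τarc v (toEquiv t)

/-- identity morphism. [cite: MochizukiAbsTopIII2015, Def 5.3 (i) p. 123] -/
def Hom.id (L : MulLineBundle F) : Hom L L where
  toEquiv := Equiv.refl _
  map_smul _ _ := rfl
  τnon_le _ _ := le_rfl
  τarc_le _ _ := le_rfl

/-- composition of morphisms. [cite: MochizukiAbsTopIII2015, Def 5.3 (i) p. 123] -/
def Hom.comp {L₁ L₂ L₃ : MulLineBundle F} (f : Hom L₁ L₂) (g : Hom L₂ L₃) : Hom L₁ L₃ where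
  toEquiv := f.toEquiv.trans g.toEquiv
  map_smul a t := by simp [f.map_smul, g.map_smul]
  τnon_le v t := (f.τnon_le v t).trans (g.τnon_le v _)
  τarc_le v t := (f.τarc_le v t).trans (g.τarc_le v _)

/-- finiteness of the support `{v | ord_v(t) ≠ 0}` of a unit `t ∈ F^×` (it is contained in the supports of `t` and
`t⁻¹` in the sense of Mathlib, both finite). [cite: MochizukiAbsTopIII2015, Def 5.3 (i) p. 122] -/
theorem finite_setOf_ordAt_ne_zero (t : Fˣ) : {v : HeightOneSpectrum (𝓞 F) | ordAt F v t ≠ 0}.Finite := by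
  refine ((HeightOneSpectrum.Support.finite (R := 𝓞 F) (t : F)).union
    (HeightOneSpectrum.Support.finite (R := 𝓞 F) ((t : F)⁻¹))).subset ?_
  intro v hv
  simp only [Set.mem_setOf_eq, ordAt, Literature.IUT.LogVolume.ord, ne_eq, neg_eq_zero] at hv
  simp only [Set.mem_union, HeightOneSpectrum.Support, Set.mem_setOf_eq, map_inv₀]
  have h0 : v.valuation F (t : F) ≠ 0 := (v.valuation F).ne_zero_iff.mpr t.ne_zero
  rcases lt_trichotomy (v.valuation F (t : F)) 1 with hlt | heq | hgt
  · exact Or.inr ((one_lt_inv₀ (zero_lt_iff.mpr h0)).mpr hlt)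
  · exact absurd (by rw [heq, WithZero.log_one]) hv
  · exact Or.inl hgt

variable (F) in
/-- the **trivial `⊠`-line bundle** (a MODEL of the structure): `L⊠[⊚] := F^×` acting on itself, `τ[v](t) := ord_v(t)`
at finite `v`, `τ[v](t) := -log|t|_v` at archimedean `v` (the `⊠`-bundle of the trivial `⊞`-line bundle under the
assignment of Def 5.3 (ii)). [cite: MochizukiAbsTopIII2015, Def 5.3 (i) p. 122] -/
def trivial : MulLineBundle F where
  T := Fˣ
  nonempty := ⟨1⟩
  bijective_smul t := ⟨fun a b h => mul_right_cancel h, fun s => ⟨s * t⁻¹, by simp⟩⟩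
  τnon v t := ordAt F v t
  τnon_smul v a t := by
    change Literature.IUT.LogVolume.ord F v ((a * t : Fˣ) : F) = _
    rw [Units.val_mul, Literature.IUT.LogVolume.ord_mul F v a.ne_zero t.ne_zero]
  τarc v t := negLogAt F v t
  τarc_smul v a t := by
    change -Real.log (v ((a * t : Fˣ) : F)) = -Real.log (v (a : F)) + -Real.log (v (t : F))
    rw [Units.val_mul, map_mul, Real.log_mul ((map_ne_zero v).mpr a.ne_zero) ((map_ne_zero v).mpr t.ne_zero)]
    ring
  finite_support t := finite_setOf_ordAt_ne_zero t

end MulLineBundle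

/-! ## Def 5.3 (ii): `⊞`-line bundles -/

/-- A **`⊞`-line bundle** on `F` (Def 5.3 (ii), trivial `Out(Π)`-twist): a rank one projective `𝒪_F`-module
`L⊞[⊚]` together with, for each archimedean `v`, a Hermitian metric `|−|_{L⊞[v]}` on `L⊞[v] = L⊞[⊚] ⊗ F_v`
(recorded by its restriction to `L⊞[⊚]`, which determines it). [cite: MochizukiAbsTopIII2015, Def 5.3 (ii) p. 123] -/
structure AddLineBundle : Type 1 where
  /-- the module `L⊞[⊚]` -/
  L : Type
  /-- additive group -/
  [addCommGroup : AddCommGroup L]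
  /-- `𝒪_F`-module -/
  [module : Module (𝓞 F) L]
  /-- finitely generated -/
  [finite : Module.Finite (𝓞 F) L]
  /-- torsion-free (automatic for projective modules over the domain `𝓞_F`; recorded to keep proofs elementary) -/
  [torsionFree : Module.IsTorsionFree (𝓞 F) L]
  /-- projective -/
  projective : Module.Projective (𝓞 F) L
  /-- of rank one -/
  rank_eq_one : Module.rank (𝓞 F) L = 1
  /-- `|x|_{L⊞[v]}` for `x ∈ L⊞[⊚]`, `v` archimedean -/
  norm : InfinitePlace F → L → ℝ
  /-- nonnegativity -/
  norm_nonneg : ∀ v x, 0 ≤ norm v x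
  /-- definiteness -/
  norm_eq_zero_iff : ∀ v x, norm v x = 0 ↔ x = 0
  /-- Hermitian: `|a·x|_v = |a|_v·|x|_v` -/
  norm_smul : ∀ v (a : 𝓞 F) (x : L), norm v (a • x) = v (a : F) * norm v x

attribute [instance] AddLineBundle.addCommGroup AddLineBundle.module AddLineBundle.finite
  AddLineBundle.torsionFree

namespace AddLineBundle

variable {F}

/-- the integral elements of `L⊞[⊚]` at `v`: "elements of norm `≤ 1`" (the lattice points of the unit ball of `L⊞[v]`).
[cite: MochizukiAbsTopIII2015, Def 5.3 (ii) p. 123] -/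
def integralAt (L : AddLineBundle F) (v : InfinitePlace F) : Set L.L := {x | L.norm v x ≤ 1}

/-- A **morphism of `⊞`-line bundles** `ζ : L⊞₁ → L⊞₂`: a nonzero `𝒪_F`-linear map such that, at each archimedean
`v`, "the induced isomorphism `ζ[v] : L⊞₁[v] ⥲ L⊞₂[v]` maps integral elements [i.e., elements of norm `≤ 1`] to
integral elements" — a condition on the COMPLETED lines `L⊞ᵢ[v] = L⊞ᵢ[⊚] ⊗ F_v`, which for one-dimensional
`F_v`-spaces is the contraction `|ζ x|₂ ≤ |x|₁` (stated on `L⊞₁[⊚]`, which determines it).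
[cite: MochizukiAbsTopIII2015, Def 5.3 (ii) p. 123] -/
structure Hom (L₁ L₂ : AddLineBundle F) : Type where
  /-- `ζ[⊚]` -/
  toLinearMap : L₁.L →ₗ[𝓞 F] L₂.L
  /-- nonzero -/
  ne_zero : toLinearMap ≠ 0
  /-- `ζ[v]` is a contraction: integral elements of `L⊞₁[v]` go to integral elements of `L⊞₂[v]` -/
  norm_le : ∀ v x, L₂.norm v (toLinearMap x) ≤ L₁.norm v x

omit [NumberField F] in
/-- a rank-one module has a nonzero element. [cite: MochizukiAbsTopIII2015, Def 5.3 (ii) p. 123] -/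
theorem exists_ne_zero (L : AddLineBundle F) : ∃ x : L.L, x ≠ 0 :=
  rank_pos_iff_exists_ne_zero.mp (by rw [L.rank_eq_one]; exact zero_lt_one)

omit [NumberField F] in
/-- any two elements of the rank-one module `L⊞[⊚]` are linearly dependent.
[cite: MochizukiAbsTopIII2015, Def 5.3 (ii) p. 123] -/
theorem exists_smul_add_smul_eq_zero (L : AddLineBundle F) (x y : L.L) :
    ∃ s t : 𝓞 F, (s ≠ 0 ∨ t ≠ 0) ∧ s • x + t • y = 0 := by
  by_contra h
  push Not at h
  have hli : LinearIndependent (𝓞 F) ![x, y] := by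
    rw [LinearIndependent.pair_iff]
    intro s t hst
    by_contra hne
    rcases not_and_or.mp hne with hs | ht
    · exact h s t (Or.inl hs) hst
    · exact h s t (Or.inr ht) hst
  have h2 := hli.cardinal_le_rank
  rw [L.rank_eq_one, Cardinal.mk_fin] at h2
  norm_num at h2

omit [NumberField F] in
/-- a morphism of `⊞`-line bundles is injective (a nonzero map between torsion-free rank-one modules).
[cite: MochizukiAbsTopIII2015, Def 5.3 (ii) p. 123] -/
theorem Hom.injective {L₁ L₂ : AddLineBundle F} (f : Hom L₁ L₂) : Function.Injective f.toLinearMap := by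
  obtain ⟨x, hx⟩ : ∃ x, f.toLinearMap x ≠ 0 := by
    by_contra h
    push Not at h
    exact f.ne_zero (LinearMap.ext h)
  rw [injective_iff_map_eq_zero]
  intro y hy
  obtain ⟨s, t, hst, h⟩ := L₁.exists_smul_add_smul_eq_zero x y
  have h2 : s • f.toLinearMap x = 0 := by
    have h3 := congrArg f.toLinearMap h
    rwa [map_add, map_smul, map_smul, hy, smul_zero, add_zero, map_zero] at h3
  rcases smul_eq_zero.mp h2 with hs | hfx
  · subst hs
    rw [zero_smul, zero_add] at h
    rcases smul_eq_zero.mp h with ht | hy0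
    · exact absurd ht (hst.resolve_left fun h0 => h0 rfl)
    · exact hy0
  · exact absurd hfx hx

/-- the identity morphism. [cite: MochizukiAbsTopIII2015, Def 5.3 (ii) p. 123] -/
def Hom.id (L : AddLineBundle F) : Hom L L where
  toLinearMap := LinearMap.id
  ne_zero h := by
    obtain ⟨x, hx⟩ := L.exists_ne_zero
    exact hx (by simpa using LinearMap.congr_fun h x)
  norm_le _ _ := le_rfl

/-- composition of morphisms (nonzero because morphisms are injective).
[cite: MochizukiAbsTopIII2015, Def 5.3 (ii) p. 123] -/
def Hom.comp {L₁ L₂ L₃ : AddLineBundle F} (f : Hom L₁ L₂) (g : Hom L₂ L₃) : Hom L₁ L₃ where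
  toLinearMap := g.toLinearMap.comp f.toLinearMap
  ne_zero h := by
    obtain ⟨x, hx⟩ := L₁.exists_ne_zero
    have h1 : g.toLinearMap (f.toLinearMap x) = 0 := by simpa using LinearMap.congr_fun h x
    have h2 : f.toLinearMap x = 0 := g.injective (by rw [h1, map_zero])
    exact hx (f.injective (by rw [h2, map_zero]))
  norm_le v x := (g.norm_le v _).trans (f.norm_le v x)

variable (F) in
/-- the **trivial `⊞`-line bundle**: "the `𝒪^Π_{M⊚}`-module `𝒪^Π_{M⊚}` equipped with its usual Hermitian metrics"
(`|x|_v` the absolute value at `v`). Rmk 5.4.3: its localizations sit inside the log-shells `𝒪 ⊆ ℐ` of Def 5.4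
(iii), (v), and its definition uses the multiplicative as well as the additive structure of `𝒪_F`.
[cite: MochizukiAbsTopIII2015, Def 5.3 (ii) p. 123] -/
def trivial : AddLineBundle F where
  L := 𝓞 F
  projective := Module.Projective.of_free
  rank_eq_one := Module.rank_self (𝓞 F)
  norm v x := v (x : F)
  norm_nonneg v x := apply_nonneg v _
  norm_eq_zero_iff v x := by
    rw [map_eq_zero]
    exact ⟨fun h => RingOfIntegers.coe_eq_zero_iff.mp h, fun h => by simp [h]⟩
  norm_smul v a x := by
    change v ((a : F) * (x : F)) = v (a : F) * v (x : F)
    exact map_mul v _ _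

/-- Def 5.3 (iii): automorphisms act through roots of unity; the coarsified category `Th⊚|⊞|` has as morphisms the
orbits of morphisms under `μ(F) = ` the torsion units of `𝒪_F` acting by scalars. Here only the MORPHISMS are
coarsified; passing to isomorphism classes of objects (the other half of "coarsified") is not performed
(TODO(general form)). [cite: MochizukiAbsTopIII2015, Def 5.3 (iii) p. 124] -/
def HomCoarse (L₁ L₂ : AddLineBundle F) : Type :=
  Quot fun f g : Hom L₁ L₂ => ∃ u : (𝓞 F)ˣ, IsOfFinOrder u ∧ g.toLinearMap = (u : 𝓞 F) • f.toLinearMap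

end AddLineBundle

/-- **Def 5.3 (iii), first sentence** (named fact): "the automorphism group of any object of `Th⊚⊡_T[M⊚]` is naturally
isomorphic to the finite abelian group `μ_{ℚ/ℤ}(M⊚_{TLG})^{Aut(Π)}`" — here: every automorphism of a `⊞`-line bundle
(a morphism with an inverse morphism) is multiplication by a root of unity of `F`. Dischargeable (End of an invertible
`𝒪_F`-module is `𝒪_F`; Kronecker: Mathlib `NumberField.Embeddings.pow_eq_one_of_norm_eq_one`).
[cite: MochizukiAbsTopIII2015, Def 5.3 (iii) p. 124] -/
def AddLineBundleAutIsRootOfUnity : Prop :=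
  ∀ (L : AddLineBundle F) (f g : AddLineBundle.Hom L L),
    f.toLinearMap.comp g.toLinearMap = LinearMap.id → g.toLinearMap.comp f.toLinearMap = LinearMap.id →
    ∃ u : (𝓞 F)ˣ, IsOfFinOrder u ∧ f.toLinearMap = (u : 𝓞 F) • LinearMap.id

/-- **Def 5.3 (ii), last paragraph**, WEAKER THAN PRINTED (named fact): the print says that THE assignment `L⊞[⊚] ↦`
(the `F^×`-torsor of nonzero sections of `L⊞[⊚] ⊗ F`, `τ[v]` = order relative to `L⊞[⊚] ⊗ 𝒪_v` resp. `-log|−|_{L⊞[v]}`)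
"determines an equivalence of categories `Th⊚⊞_T ≃ Th⊚⊠_T`"; typed here is only the EXISTENCE of an equivalence
(some `Φ` on objects and morphisms, compatible with identities and composition, bijective on hom-sets, essentially
surjective) — the canonical functor itself needs the torsor of nonzero sections of `L ⊗ F` (TODO(general form):
construct it and state the fact for it).  Rmk 5.3.1 p. 124 (RECORD, referee L2-F3; category not typed): in the style
of Cor 5.2 (iv) one defines `An⊚[Th⊚_T, |⊡|]` with objects `(M⊚_T(Π), Th⊚|⊡|_T[M⊚_T[Π]])`, and the natural functors
`EA⊚ → An⊚[Th⊚_T, |⊡|] → An⊚[Th⊚_T] → Th⊚_T → EA⊚` are all equivalences of categories.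
[cite: MochizukiAbsTopIII2015, Def 5.3 (ii) p. 124] -/
def AddMulLineBundleCategoriesEquivalent : Prop :=
  ∃ (Φ : AddLineBundle F → MulLineBundle F)
    (Φmap : ∀ {L₁ L₂ : AddLineBundle F}, AddLineBundle.Hom L₁ L₂ → MulLineBundle.Hom (Φ L₁) (Φ L₂)),
    (∀ L : AddLineBundle F, (Φmap (AddLineBundle.Hom.id L)).toEquiv = (MulLineBundle.Hom.id (Φ L)).toEquiv) ∧
    (∀ {L₁ L₂ L₃ : AddLineBundle F} (f : AddLineBundle.Hom L₁ L₂) (g : AddLineBundle.Hom L₂ L₃),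
      (Φmap (f.comp g)).toEquiv = ((Φmap f).comp (Φmap g)).toEquiv) ∧
    (∀ L₁ L₂ : AddLineBundle F, Function.Bijective (Φmap : AddLineBundle.Hom L₁ L₂ → _)) ∧
    ∀ M : MulLineBundle F, ∃ (L : AddLineBundle F) (e : MulLineBundle.Hom (Φ L) M)
      (e' : MulLineBundle.Hom M (Φ L)), (e.comp e').toEquiv = Equiv.refl _ ∧ (e'.comp e).toEquiv = Equiv.refl _

/-! ## Def 5.9 (iii): the global log-volume `μ^log_⊚` -/

/-- **Def 5.9 (iii)**: the global log-volume of a line bundle from its local data,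
`μ^log_⊚(L) := Σ_{v ∈ V^arc} 2·μ^log_v(S_v)^⊚/d_v^mod + Σ_{v ∈ V^non} μ^log_v(S_v)^⊚/d_v^mod ∈ R_⊚V ≅ ℝ`, where
`S_v` is the closure of the image of `L⊞[⊚]` (finite `v`) resp. the unit ball of `|−|_{L⊞[v]}` (archimedean `v`)
transported into the trivial bundle, `μ^log_v` the log-volumes of Prop 5.7 (read in `R_⊚V` via Def 5.9 (i)), and
`d_v^mod = [F_ṽ : (F_mod)_v]` (`F` is totally imaginary, Def 5.1 (ii), so each `F_ṽ ≅ ℂ` and `2/d_v^mod` is the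
product-formula weight `mult` of the place `v` of `F_mod`); "the sum is finite since `μ^log_v(S_v) = 0` for all but
finitely many `v`" — here as a formula in the local log-volumes and weights (`finsum`; junk value `0` if the support
is infinite).
[cite: MochizukiAbsTopIII2015, Def 5.9 (iii) p. 144] -/
def globalLogVolume (dnon : HeightOneSpectrum (𝓞 F) → ℕ) (darc : InfinitePlace F → ℕ)
    (μnon : HeightOneSpectrum (𝓞 F) → ℝ) (μarc : InfinitePlace F → ℝ) : ℝ :=
  (∑ᶠ v : InfinitePlace F, 2 * μarc v / darc v) + ∑ᶠ v : HeightOneSpectrum (𝓞 F), μnon v / dnon v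

/-- the archimedean part is a finite sum over the (finitely many) archimedean places.
[cite: MochizukiAbsTopIII2015, Def 5.9 (iii) p. 144] -/
theorem globalLogVolume_eq (dnon : HeightOneSpectrum (𝓞 F) → ℕ) (darc : InfinitePlace F → ℕ)
    (μnon : HeightOneSpectrum (𝓞 F) → ℝ) (μarc : InfinitePlace F → ℝ) :
    globalLogVolume F dnon darc μnon μarc =
      (∑ v : InfinitePlace F, 2 * μarc v / darc v) + ∑ᶠ v : HeightOneSpectrum (𝓞 F), μnon v / dnon v := by
  rw [globalLogVolume, finsum_eq_sum_of_fintype]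

/-- the local log-volume data of a `⊠`-line bundle at a global section `t`: `μ^log_v(S_v) = -τ[v](t)·log q_v`
resp. `-τ[v](t)` (archimedean, radial log-volume of the ball of radius `e^{-τ}`), given the residue cardinalities
`q_v` — the dictionary between trivializations and log-volumes of the localized trivial bundle (Prop 5.7 (i)(a):
`μ^log(𝔪^n) = -n·log q`). [cite: MochizukiAbsTopIII2015, Def 5.9 (iii) p. 144] -/
def MulLineBundle.localLogVolumes (L : MulLineBundle F) (q : HeightOneSpectrum (𝓞 F) → ℕ) (t : L.T) :
    (HeightOneSpectrum (𝓞 F) → ℝ) × (InfinitePlace F → ℝ) :=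
  (fun v => -(L.τnon v t : ℝ) * Real.log (q v), fun v => -L.τarc v t)

/-- **Def 5.9 (iii), well-definedness** (named fact): `μ^log_⊚(L)` "depends only on the isomorphism class of `L⊞` and
is independent of the choice of `ζ, ζ₀`" — "as is well-known from elementary number theory, i.e., the so-called
product formula" — typed for `⊠`-line bundles as: the global log-volume computed from the local data at a global
section `t` does not depend on `t`, for `F = F_mod` (`d_v = 1`) TOTALLY IMAGINARY as in Def 5.1 (ii) (every
archimedean completion is `ℂ`, so the printed weight `2` is the weight `mult(v) = 2` of the product formula at a complex
place; over a base with real places the printed formula divides by `d_v^mod = [F_ṽ : (F_mod)_v] = 2` there, i.e. the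
weight becomes `InfinitePlace.mult v`). Dischargeable from Mathlib's product formula `NumberField.prod_abs_eq_one`.
[cite: MochizukiAbsTopIII2015, Def 5.9 (iii) p. 144] -/
def GlobalLogVolumeWellDefined : Prop :=
  (∀ v : InfinitePlace F, v.IsComplex) →
  ∀ (L : MulLineBundle F) (q : HeightOneSpectrum (𝓞 F) → ℕ),
    (∀ v, q v = Nat.card (𝓞 F ⧸ v.asIdeal)) →
    ∀ t t' : L.T,
      globalLogVolume F (fun _ => 1) (fun _ => 1) (L.localLogVolumes F q t).1 (L.localLogVolumes F q t).2 =
        globalLogVolume F (fun _ => 1) (fun _ => 1) (L.localLogVolumes F q t').1 (L.localLogVolumes F q t').2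

end Literature.AnabelianGeometry.AbsoluteAnabelian

end
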